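import Mathlib

set_option linter.dupNamespace false

/-!
# B3♭ at COPY LEVEL — Pic⁰-coloured liveness, co-killability and the column criterion (monad-4 g26)

Typed *specification / finite-combinatorics* file for the cell `hsemireg-monad-4`, generation g26
(unit `hsemireg-monad-4-g26`, crux item `stmt-HodgeConjecture-18881`, decl `BlochSeedDiscOne`;
memo `B3FLAT-COPYLEVEL-monad4-g26.md`, engine `coliso.py`).

**Status sentence.** Nothing in this file is proved toward HC / HC_CM / HC_AV / №4 / 26512 / 18881 / H2.
It records, kernel-checked, the finite combinatorics of ONE further maps-free necessary condition for a
3-term display `0 → A → N → C → 0` (`E = ker q / im i` locally free of the designed rank) on letter designs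
over `X = (E_i × E_i)^4`, now at the COPY level: every copy `κ` of a letter cell carries its own
`P_κ ∈ Pic⁰(X) = (Ŝ)^4` ("colour").  Designs ≠ displays ≠ monads ≠ sheaves ≠ a SEED.

## Dictionary (one factor `S = E_i × E_i`, letters `14I, 15I, R_ζ = 12I + ℓ_ζ`)

A factor step `λ → λ'` between copies with colour difference `τ ∈ Ŝ` is a section of
`O(λ' − λ) ⊗ P_τ`.  By the index theorem for line bundles on an abelian surface and the description of
degenerate (non-ample effective) line bundles [Birkenhake–Lange, *Complex Abelian Varieties*, §3.4–3.5,
Thm. 3.5.5 (vanishing), 1.6.5/3.6 (index = number of negative eigenvalues), Riemann–Roch 3.6.3]: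

| step `λ → λ'`            | class `δ`        | `h⁰(O(δ) ⊗ P_τ)`          | zero locus of a section      | killable |
|--------------------------|------------------|---------------------------|------------------------------|----------|
| `λ → λ` (identity)       | `0`              | `1` iff `τ = 0`, else `0` | nowhere                      | no       |
| `14I → 15I` (theta)      | `I = Θ`, `n = 1` | `1` for every `τ`         | the translate `Θ_τ`          | yes      |
| `R_ζ → 14I` (null)       | `F_ζ = I − ℓ_ζ`  | `1` iff `τ ∈ B_ζ`, else 0 | ONE fibre translate `F_ζ+t(τ)` | yes    |
| `R_ζ → 15I` (ample)      | `2I − ℓ_ζ`, `n=3`| `3` for every `τ`         | a moving curve               | no (as a class) |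
| all other steps          | `a ≤ 0` or `n<0` | `0`                       | —                            | —        |

(`B_ζ = ker(Ŝ → F̂_ζ)`, a 1-dimensional subtorus; `Γ = ⋂_ζ B_ζ ∋ τ₀ ≠ 0`, the common `(1+i)`-torsion
character: TWIN colours `π, π + τ₀` see the same null-liveness.)  CO-KILLABILITY in one factor: a point
lies on at most two of the chosen divisors in general position and NEVER on two parallel fibre translates
(`Θ·Θ' = 2`, `Θ·F_ζ = 2`, `F_ζ·F_ζ' ∈ {2,4}` for `ζ ≠ ζ'`, `F_ζ² = 0`); this direction is SOUND (it only
under-estimates the killer).  Hence, from an A-copy of letter `14I` the `t` colour versions of `15I`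
among its live targets die together iff `t ≤ 2` (`theta_versions`), and from an A-copy of `R_ζ` the `u`
aligned versions of `14I` die together iff `u ≤ 1` (`null_versions`): the COLUMN CRITERION in closed form
(`reach`).  Under the designer-optimal assumption that every colour version of every N-cell is populated,
an A-copy of a P-cell `x` is forced to `a = 0` unless some N-cell `y ≠ x` is reachable in every factor
(`Escapes`).  `escape_theta` / `escape_null` are the two un-isolation moves; `letterLevel_isolation` is
g25's law as the template `(t,u) = (1,1)`; the instances reproduce the `coliso.py` census on the designs
`2f9bdad8` (N = even `#14I`) and `7934b9bc` (N = not (odd `#14I` and odd `#R`)).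
-/

namespace Summit.HodgeConjecture.HodgeConjecture.Cruxes.BlochSeedDiscOne.CopyLevel

/-! ## Letters, step kinds and the index-theorem table -/

/-- The six letters of the 2-level alphabet of record. -/
inductive L | l14 | l15 | r1 | rm | ri | rj
  deriving DecidableEq, Fintype, Repr

/-- The null letters `R_ζ = 12I + ℓ_ζ`. -/
def L.isRay : L → Bool
  | .r1 | .rm | .ri | .rj => true
  | _ => false

/-- Kind of a factor step `a → b` (class `δ = b − a`). -/
inductive Kind | dead | ident | theta | null | ample
  deriving DecidableEq, Repr

/-- The step kinds on the alphabet. -/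
def kind (a b : L) : Kind :=
  if a = b then .ident
  else if a.isRay && decide (b = L.l14) then .null
  else if decide (a = L.l14) && decide (b = L.l15) then .theta
  else if a.isRay && decide (b = L.l15) then .ample
  else .dead

/-- `h⁰(O(δ) ⊗ P_τ)` as a function of the kind and of the ALIGNMENT bit of the colour difference
(`τ = 0` for the identity, `τ ∈ B_ζ` for the null step; irrelevant otherwise) — the table above. -/
def h0 : Kind → Bool → ℕ
  | .dead, _ => 0
  | .ident, al => if al then 1 else 0
  | .theta, _ => 1
  | .null, al => if al then 1 else 0
  | .ample, _ => 3

/-- A live step is KILLABLE when its blocks vanish on a divisor: theta and null steps. -/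
def Kind.killable : Kind → Bool
  | .theta | .null => true
  | _ => false

/-- Copy-level liveness of a factor step given the alignment bit of the colour difference. -/
def liveCol (a b : L) (aligned : Bool) : Bool := decide (0 < h0 (kind a b) aligned)

/-- The liveness table spelled out: identity needs `τ = 0`, null needs `τ ∈ B_ζ`, theta and ample
are live for every colour difference, everything else is dead. -/
theorem liveCol_table : ∀ a b : L, ∀ al : Bool,
    liveCol a b al = ((decide (a = b) && al) || (a.isRay && decide (b = L.l14) && al)
      || (decide (a = L.l14) && decide (b = L.l15)) || (a.isRay && decide (b = L.l15))) := by
  decide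

/-- Killable live steps are exactly the `h⁰ = 1` steps other than the identity. -/
theorem killable_iff : ∀ a b : L, ∀ al : Bool, liveCol a b al = true →
    ((kind a b).killable = true ↔ (h0 (kind a b) al = 1 ∧ kind a b ≠ Kind.ident)) := by
  decide

/-- The live NON-killable steps (identity, ample) preserve the letter `14I` and never leave a
`15I`; the killable ones are `14I → 15I` and `R_ζ → 14I`. -/
theorem nonkillable_live_steps : ∀ a b : L, ∀ al : Bool, liveCol a b al = true →
    (kind a b).killable = false → (b = a ∨ (a.isRay = true ∧ b = L.l15)) := by
  decide

/-! ## Co-killability: capacity two per factor, parallel fibres excluded -/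

/-- Letters as classes `[a,x,y] = a·Θ + x·X + y·Y` (`Θ² = 2`, `X² = Y² = −2`). -/
def cls : L → ℤ × ℤ × ℤ
  | .l14 => (14, 0, 0) | .l15 => (15, 0, 0)
  | .r1 => (13, 1, 0) | .rm => (13, -1, 0) | .ri => (13, 0, 1) | .rj => (13, 0, -1)

/-- Intersection form `2(aa' − xx' − yy')`. -/
def dot (u v : ℤ × ℤ × ℤ) : ℤ := 2 * (u.1 * v.1 - u.2.1 * v.2.1 - u.2.2 * v.2.2)

/-- Class of the step `a → b`. -/
def stepCls (a b : L) : ℤ × ℤ × ℤ := ((cls b).1 - (cls a).1, (cls b).2.1 - (cls a).2.1, (cls b).2.2 - (cls a).2.2)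

/-- Gram table of the killable classes: `Θ·Θ = 2`, `Θ·F_ζ = 2`, `F_ζ·F_ζ = 0` (parallel translates are
disjoint), `F_ζ·F_ζ' ∈ {2,4}` for `ζ ≠ ζ'`.  Two divisors of classes with positive intersection meet, so
any two killable divisors in one factor are co-killable except two translates of the same fibre class. -/
theorem gram_killable :
    dot (stepCls L.l14 L.l15) (stepCls L.l14 L.l15) = 2 ∧
    (∀ a : L, a.isRay = true → dot (stepCls L.l14 L.l15) (stepCls a L.l14) = 2 ∧
                                dot (stepCls a L.l14) (stepCls a L.l14) = 0) ∧
    (∀ a b : L, a.isRay = true → b.isRay = true → a ≠ b →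
        dot (stepCls a L.l14) (stepCls b L.l14) = 2 ∨ dot (stepCls a L.l14) (stepCls b L.l14) = 4) := by
  decide

/-- **Theta capacity.**  From an A-copy of letter `14I` the live `15I`-targets in one factor fall into
`t` distinct `Θ`-translates (one per colour version; `Θ` is principal, so `τ ↦ Θ_τ` is injective); a kill
set holds at most two of them, so all versions die together iff `t ≤ 2`. -/
theorem theta_versions (t : ℕ) :
    (∃ K : Finset (Fin t), K.card ≤ 2 ∧ ∀ v, v ∈ K) ↔ t ≤ 2 := by
  constructor
  · rintro ⟨K, hK, hall⟩
    have hU : K = Finset.univ := Finset.eq_univ_iff_forall.mpr hall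
    subst hU
    simpa [Finset.card_univ, Fintype.card_fin] using hK
  · intro ht
    exact ⟨Finset.univ, by simpa [Finset.card_univ, Fintype.card_fin] using ht, fun v => Finset.mem_univ v⟩

/-- **Null capacity (twin lemma).**  From an A-copy of `R_ζ` the aligned `14I`-versions in one factor sit
on `u` DISJOINT parallel fibre translates; a kill set holds at most one of them, so they die together iff
`u ≤ 1`.  Twin colours `π, π + τ₀` (`τ₀ ∈ ⋂_ζ B_ζ`) give `u = 2` for every `ζ` at once. -/
theorem null_versions (u : ℕ) :
    (∃ K : Finset (Fin u), K.card ≤ 1 ∧ ∀ w, w ∈ K) ↔ u ≤ 1 := by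
  constructor
  · rintro ⟨K, hK, hall⟩
    have hU : K = Finset.univ := Finset.eq_univ_iff_forall.mpr hall
    subst hU
    simpa [Finset.card_univ, Fintype.card_fin] using hK
  · intro hu
    exact ⟨Finset.univ, by simpa [Finset.card_univ, Fintype.card_fin] using hu, fun w => Finset.mem_univ w⟩

/-! ## The column criterion in closed form -/

/-- `reach t u a b`: under a template with `t` colour versions of `15I` and `u` aligned versions of `14I`
per `B_ζ`-coset in this factor, SOME live coloured copy of letter `b` survives every admissible kill set
chosen at an A-copy of letter `a`: the identity and ample targets always, the theta targets iff `t ≥ 3`,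
the null targets iff `u ≥ 2`. -/
def reach (t u : ℕ) (a b : L) : Bool :=
  decide (a = b) || (a.isRay && decide (b = L.l15)) ||
  (decide (a = L.l14) && decide (b = L.l15) && decide (3 ≤ t)) ||
  (a.isRay && decide (b = L.l14) && decide (2 ≤ u))

/-- A cell of `X = S^4`. -/
abbrev Cell := Fin 4 → L

/-- A per-factor template: `(t15, nu14)` for each factor. -/
abbrev Template := Fin 4 → ℕ × ℕ

/-- The letter level (g22–g25): one colour per letter per factor. -/
def T0 : Template := fun _ => (1, 1)

/-- Theta-spread (`≥ 3` versions of `15I`) in the factors of `S`, letter level elsewhere. -/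
def TH (S : Finset (Fin 4)) : Template := fun f => (if f ∈ S then 3 else 1, 1)

/-- Twin / aligned `14I`-pairs in the factors of `S`, letter level elsewhere. -/
def TW (S : Finset (Fin 4)) : Template := fun f => (1, if f ∈ S then 2 else 1)

/-- An A-copy of the P-cell `x` ESCAPES isolation under template `T` against the N-support `N` (all colour
versions populated): some N-cell `y ≠ x` is reachable in every factor, so no product point kills the whole
column of `i` through the copy. -/
def Escapes (T : Template) (N : Cell → Bool) (x : Cell) : Prop :=
  ∃ y : Cell, N y = true ∧ y ≠ x ∧ ∀ f, reach (T f).1 (T f).2 (x f) (y f) = true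

/-- KILLABLE = not escaping: every A-copy of `x` has its column of `i` vanish at some point of `X`, so a
display with `E` locally free has NO A-copy of `x` (`a(x) = 0`). -/
def AKillable (T : Template) (N : Cell → Bool) (x : Cell) : Prop := ¬ Escapes T N x

/-- Number of occurrences of a letter in a cell. -/
def count (l : L) (x : Cell) : ℕ := (Finset.univ.filter fun f => x f = l).card

/-- Number of null letters in a cell. -/
def countRay (x : Cell) : ℕ := (Finset.univ.filter fun f => (x f).isRay = true).card

/-- N-support of the design of record `2f9bdad8` (g24): the cells with an even number of `14I`. -/
def N2f9 (y : Cell) : Bool := decide (count L.l14 y % 2 = 0)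

/-- N-support of the theta-shadowed design `7934b9bc` (g26, rounded from the `jointlp_theta` LP-ALIVE
point): every cell except those with an odd number of `14I` AND an odd number of null letters. -/
def N7934 (y : Cell) : Bool := !(decide (count L.l14 y % 2 = 1) && decide (countRay y % 2 = 1))

/-! ### Letter level = template `(1,1)`: g25's isolation law recovered -/

theorem reach_T0 : ∀ a b : L, reach 1 1 a b = true → (b = a ∨ (a.isRay = true ∧ b = L.l15)) := by
  decide

theorem reach_T0_preserves_14 : ∀ a b : L, reach 1 1 a b = true → (a = L.l14 ↔ b = L.l14) := by
  decide

/-- Small templates are the letter level. -/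
theorem reach_small (t u : ℕ) (ht : t ≤ 2) (hu : u ≤ 1) (a b : L) : reach t u a b = reach 1 1 a b := by
  have h3 : ¬ (3 ≤ t) := by omega
  have h2 : ¬ (2 ≤ u) := by omega
  simp [reach, h3, h2]

/-- **Letter-level isolation law** (g25, restated): if every N-cell differs from `x` in its number of
`14I`-letters then every A-copy of `x` is killable under `T0`. -/
theorem letterLevel_isolation (N : Cell → Bool) (x : Cell)
    (hN : ∀ y, N y = true → count L.l14 y ≠ count L.l14 x) : AKillable T0 N x := by
  rintro ⟨y, hy, -, hr⟩
  apply hN y hy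
  unfold count
  congr 1
  ext f
  simp only [Finset.mem_filter, Finset.mem_univ, true_and]
  exact ((reach_T0_preserves_14 (x f) (y f) (hr f))).symm

/-- On `2f9bdad8` (N = even `#14I`) every P-cell with an odd number of `14I` is A-killable at the letter
level (the 520 cells `14I·R³, 14I·15I·R², 14I·15I²·R, 14I·15I³, 14I³·15I, 14I³·R` of the census). -/
theorem iso_2f9_T0 (x : Cell) (hx : count L.l14 x % 2 = 1) : AKillable T0 N2f9 x := by
  apply letterLevel_isolation
  intro y hy h
  simp only [N2f9, decide_eq_true_eq] at hy
  omega

/-! ### The two un-isolation moves of the copy level -/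

/-- **Theta spread un-isolates.**  If `x_f₀ = 14I`, the template has `≥ 3` versions of `15I` in factor
`f₀`, and the cell `x` with `15I` put at `f₀` is an N-cell, then an A-copy of `x` escapes: its theta targets
at `f₀` lie on three distinct `Θ`-translates, identity elsewhere. -/
theorem escape_theta (T : Template) (N : Cell → Bool) (x : Cell) (f₀ : Fin 4)
    (hx : x f₀ = L.l14) (ht : 3 ≤ (T f₀).1) (hN : N (Function.update x f₀ L.l15) = true) :
    Escapes T N x := by
  refine ⟨Function.update x f₀ L.l15, hN, ?_, ?_⟩
  · intro h
    have h1 := congrFun h f₀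
    rw [Function.update_self, hx] at h1
    exact absurd h1 (by decide)
  · intro f
    by_cases hf : f = f₀
    · subst hf
      rw [Function.update_self, hx]
      simp [reach, ht]
    · rw [Function.update_of_ne hf]
      simp [reach]

/-- **Aligned pair (twin) un-isolates.**  If `x_f₀ = R_ζ`, the template has `≥ 2` aligned versions of
`14I` in factor `f₀`, and `x` with `14I` put at `f₀` is an N-cell, then an A-copy of `x` escapes: its null
targets at `f₀` lie on two disjoint parallel fibres. -/
theorem escape_null (T : Template) (N : Cell → Bool) (x : Cell) (f₀ : Fin 4)
    (hx : (x f₀).isRay = true) (hu : 2 ≤ (T f₀).2) (hN : N (Function.update x f₀ L.l14) = true) :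
    Escapes T N x := by
  refine ⟨Function.update x f₀ L.l14, hN, ?_, ?_⟩
  · intro h
    have h1 := congrFun h f₀
    rw [Function.update_self] at h1
    rw [← h1] at hx
    exact absurd hx (by decide)
  · intro f
    by_cases hf : f = f₀
    · subst hf
      rw [Function.update_self]
      simp [reach, hx, hu]
    · rw [Function.update_of_ne hf]
      simp [reach]

/-- **Ample shadow un-isolates already at the letter level.**  If `x_f₀ = R_ζ` and `x` with `15I` put at
`f₀` is an N-cell then an A-copy of `x` escapes under EVERY template (the ample step `R_ζ → 15I` is never
killable) — the mechanism behind the theta-shadowed LP point of g26 (`N ∋ 14I·15I·R²` shadows the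
A-copies of `14I·R³`). -/
theorem escape_ample (T : Template) (N : Cell → Bool) (x : Cell) (f₀ : Fin 4)
    (hx : (x f₀).isRay = true) (hN : N (Function.update x f₀ L.l15) = true) :
    Escapes T N x := by
  refine ⟨Function.update x f₀ L.l15, hN, ?_, ?_⟩
  · intro h
    have h1 := congrFun h f₀
    rw [Function.update_self] at h1
    rw [← h1] at hx
    exact absurd hx (by decide)
  · intro f
    by_cases hf : f = f₀
    · subst hf
      rw [Function.update_self]
      simp [reach, hx]
    · rw [Function.update_of_ne hf]
      simp [reach]

/-! ### Census instances (the `coliso.py` table, kernel-checked on representatives) -/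

/-- `14I·R³` on `2f9bdad8`: killable at the letter level, escaping under theta spread at its `14I`-factor
(target `15I·R³ ∈ N`, 28 copies per cell on the design). -/
theorem census_4RRR_2f9 :
    AKillable T0 N2f9 ![L.l14, L.rm, L.rm, L.rm] ∧ Escapes (TH {0}) N2f9 ![L.l14, L.rm, L.rm, L.rm] := by
  refine ⟨iso_2f9_T0 _ (by decide), ?_⟩
  exact escape_theta _ _ _ 0 (by decide) (by decide) (by decide)

/-- `14I³·R` on `2f9bdad8`: escaping under a twin pair at its `R`-factor (target `14I⁴ ∈ N`, the hub). -/
theorem census_444R_2f9 :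
    AKillable T0 N2f9 ![L.rm, L.l14, L.l14, L.l14] ∧ Escapes (TW {0}) N2f9 ![L.rm, L.l14, L.l14, L.l14] := by
  refine ⟨iso_2f9_T0 _ (by decide), ?_⟩
  exact escape_null _ _ _ 0 (by decide) (by decide) (by decide)

/-- `14I³·15I` on `2f9bdad8`: a twin pair does NOT un-isolate it (it has no null letter and theta spread is
absent) — it stays killable under `TW univ`; theta spread at a `14I`-factor does (target `14I²·15I² ∈ N`). -/
theorem census_4445_2f9 :
    AKillable (TW Finset.univ) N2f9 ![L.l14, L.l14, L.l14, L.l15] ∧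
    Escapes (TH {0}) N2f9 ![L.l14, L.l14, L.l14, L.l15] := by
  refine ⟨?_, escape_theta _ _ _ 0 (by decide) (by decide) (by decide)⟩
  rintro ⟨y, hy, hne, hr⟩
  have hTW : ∀ f : Fin 4, ((TW Finset.univ) f).1 = 1 ∧ ((TW Finset.univ) f).2 = 2 := by
    intro f; simp [TW]
  -- under (1,2) a `14I` or `15I` source letter only reaches itself
  have key : ∀ a b : L, a.isRay = false → reach 1 2 a b = true → b = a := by decide
  apply hne
  funext f
  have hr' := hr f
  rw [(hTW f).1, (hTW f).2] at hr'
  have hxf : (![L.l14, L.l14, L.l14, L.l15] f).isRay = false := by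
    fin_cases f <;> decide
  exact key _ _ hxf hr'

/-- On the theta-shadowed design `7934b9bc` the cells `14I·R³` escape ALREADY at the letter level (ample
shadow `14I·15I·R² ∈ N`), while `14I³·15I`, `14I·15I³` and `15I⁴` stay killable there — exactly the cells the
joint LP oriented as pure quotient (`C`) copies. -/
theorem census_7934_T0 :
    Escapes T0 N7934 ![L.l14, L.rm, L.rm, L.rm] ∧
    AKillable T0 N7934 ![L.l14, L.l14, L.l14, L.l15] ∧
    AKillable T0 N7934 ![L.l14, L.l15, L.l15, L.l15] ∧
    AKillable T0 N7934 ![L.l15, L.l15, L.l15, L.l15] := by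
  refine ⟨escape_ample _ _ _ 3 (by decide) (by decide), ?_, ?_, ?_⟩ <;>
  · rintro ⟨y, -, hne, hr⟩
    apply hne
    funext f
    have h := reach_T0 _ _ (hr f)
    fin_cases f <;> simp_all (config := {decide := true})

end Summit.HodgeConjecture.HodgeConjecture.Cruxes.BlochSeedDiscOne.CopyLevel
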